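import Summits.BirchSwinnertonDyer.Rank1Residual.X11b.RouteOpenInputsAgree
import Summits.BirchSwinnertonDyer.Rank1Residual.X11b.RouteR1BDPValueCoreFrame
import Summits.BirchSwinnertonDyer.Rank1Residual.X11b.BDPRouteOpenInputFromLever
import HarnessLib

/-!
# Route `ErratumRoadFive`, crux `OpenInputIMC` (item stmt-BirchSwinnertonDyer-19061): the EQUALITY
# road — the erratum's Thm. 1.1 (= Castella arXiv:2409.01360 Thm. 3.1) in tree currency, at EVERY
# frame (H3∀′ = `R1.IMCEqAllFramesOnTree`), plus THEOREM C♯ (H2) give route p2's open input on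
# `R1Population ∩ Locus` AND on the semistable part of `R1Population` off the Locus

Cell `bsd-stepL` (run/shared/lean/pub/bsd-stepL/), seat `bsd-stepL-imc-p1` (prover; D-0074 row A:
"Cas24 → FW21 Thm. 4.41 → `P2OpenInputOnTreeAt`"), `--supports stmt-BirchSwinnertonDyer-19061`;
companion of `Theorems/ErratumRoadFiveOpenInputIMCReduction.lean` (p417457: the ONE-SIDED road from
H3 = `P2.IMCDivIntCoreFrameAtErratumData`). HONEST FRAMING: nothing here proves the crux; BSD is
proved for no pair by this; every published ∕ cited named fact is a HYPOTHESIS; H2 and H3∀′ are typed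
OPEN shapes (H3∀′ ⇐ erratum Thm. 1.1 ⇐ erratum Thm. 2.3 ⇐ [FW21, Thm. 4.41], PREPRINT). THEOREMS ONLY
(no definition, no named fact, no `sorry`); pure composition of landed kernels (multr1-p1 gens 22–26,
multr1-p2 gen 18, x11b3-p9, lit-cw gen 9, bdp p408571).

## The currency

* H3∀′ = `R1.IMCEqAllFramesOnTree W p` (X11b/RouteR1HalvesAllFrames.lean): at every ERRATUM datum of
  the pair (A′-hypotheses, `r_an = 1`, an odd non-split `E[p]`-ramified `q ≠ p`, an erratum field `K`
  for `q` with [Cas20, §2.5]'s standing hypotheses, a Manin-good parametrisation datum, a non-torsion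
  Heegner point), for EVERY newform `f` of `E`, every anticyclotomic `(κ, γ)`, every `ι' : ℚ̄_p ≃ ℂ`,
  `w₀`, and EVERY frame `(Ω_K ≠ 0, Ω_p ∈ R₀ˣ, L ∈ R₀⟦T⟧)` with Castella's interpolation property
  `IsBDPLFunction`: the main-conjecture EQUALITY `Ch_Λ(X_ac^∅(E[p^∞]))·R₀⟦T⟧ = (L)`
  (`R1.IMCEqOnTreeAt`). This is the erratum's Thm. 1.1 "`Ch_Λ(X_ac(E[p^∞]))Λ_{R₀} = (L_p(f))`" read
  on tree objects with `L_p(f)` CHARACTERISED by Cas18 Thm. 3.1's interpolation property (Thm. 1.1's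
  hypotheses (i)–(iv) hold at erratum data: `thm11Hypotheses_of_isErratumField`) — the shape a typed
  "Cas24 Thm. 3.1 ∕ erratum Thm. 1.1" fact should be derivable into.
* H2 = `R1.BDPValueCoreFrameOnTree W p` (bdp, PROOF-BDP §21 THEOREM C♯; on semistable `E` a THEOREM
  from the registered Cas18 Thms. 3.1–3.2, `R1.bdpValueCoreFrameOnTree_of_thm32`): SOME frame with
  the interpolation property and the value at `𝟙`. It supplies in particular the EXISTENCE of a frame
  on non-semistable pairs, which is what turns H3∀′ into route R1's ∃-shaped input H3∃⁻.

## What this file proves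

* §1 `imcEqCoreFrameOnTree_of_bdpValueCoreFrame_of_imcEqAllFrames` — H2 ∧ H3∀′ ⟹ H3∃⁻
  (`R1.IMCEqCoreFrameOnTree`) on ANY pair (frame from H2, equality from H3∀′; the semistable ∕ A206
  hypothesis of multr1-p1's `R1.imcEqCoreFrameOnTree_of_imcEqAllFrames_of_bdpExists` is gone); hence
  H3♭ core (`P2.IMCDivIntCoreFrameAtErratumData`, the input of p417457) by forgetting one inclusion.
* §2 `openInputOnTreeAt_of_r1Population_of_not_dvd_of_bdpValueCoreFrame_of_imcEqAllFrames` — on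
  `R1Population ∩ Locus`: H2 ∧ H3∀′ ⟹ `P2OpenInputOnTreeAt W p` from 9 PUBLISHED + 5 CITED facts
  (route R1's equality record `R1.bsdp_of_bdpValueCoreFrame_of_imcEqCoreFrame_record` ⟹ `BSD(E,p)`;
  control on the Locus `p2ControlOnTreeAt_of_locus`; tightness `P2.openInputOnTreeAt_of_bsdp_of_ram`).
* §3 `openInputOnTreeAt_of_r1Population_of_semistable_of_imcEqAllFrames` — on the SEMISTABLE part of
  `R1Population`, ON OR OFF the Locus (`p ∣ ∏c` allowed; the equality road needs no Euler-system half
  and no height certificate): H3∀′ ALONE (H2 from print, `h32`) ⟹ `P2OpenInputOnTreeAt W p`, the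
  control identity off the Locus coming from the PUBLISHED Cas18 Thm. 2.3 (`h23`,
  `p2ControlOnTreeAt_of_thm23_of_semistable`).
* §4 class-level forms for the planner's split (child R of p417457's split from H2 ∧ H3∀′; the
  semistable off-Locus piece of child ram′ from H3∀′).

HONEST LOCUS: `R1Population ∩ Locus` = 1 201 479 and `R1Population ∩ {p ∣ ∏c}` = 32 726 of the
2 267 348 X11b-shape pairs at `p ≥ 5`, `N < 5·10⁵` (multr1-p1 `census500k`; semistable part of
`R1Population` 555 199; the semistable ∩ `{p ∣ ∏c}` count is not taken here). Outside stay the same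
(ram) sub-atoms as in p417457 (all `E[p]`-ramified multiplicative `q ≠ p` split ∕ no second ramified
multiplicative prime ∕ `q = 2` only ∕ `E(ℚ_p)[p] ≠ 0`) and the NON-semistable `p ∣ ∏c` pairs.
CONDITIONAL; nothing booked; no label changes; closes rung K2 of BirchSwinnertonDyer for NO pair.

References: [Castella2018Erratum] Thm. 1.1 (i)–(iv), Thm. 2.3, (2.4), Thm. A′ (pp. 1–4);
[Castella2018] Thms. 2.3, 3.1, 3.2, §5 (arXiv:1704.06608 pp. 5, 9, 12); Castella arXiv:2409.01360 Thm.
3.1 (PREPRINT); [FouquetWan2021] Thm. 4.41 (PREPRINT); [Castella2020JIMJ] §2.5, Thm. 2.11;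
[JetchevSkinnerWan2017] Thm. 3.3.1, §7.4.1; [Skinner2016PacificMC] Thm. C; [CaiShuTian2014] Thm. 1.1;
[FriedbergHoffstein1995] Thm. B; [Mazur1978] Cor. 4.1; [Brink2007]; [Miller2011LMS] Def. 1.1.
-/

set_option autoImplicit false

noncomputable section

open scoped Classical

open WeierstrassCurve NumberField IsDedekindDomain Field
open Literature.NumberTheory.EllipticCurves Literature.NumberTheory.EllipticCurves.GreenbergSelmer
open Literature.NumberTheory.EllipticCurves.ModularForms
open Literature.NumberTheory.EllipticCurves.Rank1Residual
open Literature.NumberTheory.EllipticCurves.Rank1Residual.Typed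
open Literature.NumberTheory.EllipticCurves.Wuthrich2014
open Literature.NumberTheory.EllipticCurves.Castella2018
open Literature.NumberTheory.GaloisRepresentations
open Literature.NumberTheory.GaloisCohomology
open Summit.BirchSwinnertonDyer.Rank1Residual Summit.BirchSwinnertonDyer.Rank1Residual.X11b

namespace Summit.BirchSwinnertonDyer.BirchSwinnertonDyer.Theorems

/-! ### §1 H2 ∧ H3∀′ ⟹ H3∃⁻ (and the one-sided core shape) on ANY pair -/

section Frames

variable {W : WeierstrassCurve ℚ} [W.IsElliptic] [W.IsGloballyMinimal] {p : ℕ} [Fact p.Prime]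

/-- **H2 ∧ H3∀′ ⟹ H3∃⁻ on ANY pair.** At an erratum datum read through `w₀`, H2
(`R1.BDPValueCoreFrameOnTree`) supplies a frame `(Ω_K ≠ 0, Ω_p ∈ R₀ˣ, L)` of `f_{Dt}` at `𝔭_{ι'}`
with Castella's interpolation property; H3∀′ (`R1.IMCEqAllFramesOnTree`: the erratum's Thm. 1.1 at
EVERY frame) gives the main-conjecture equality for that `L`. Multr1-p1's
`R1.imcEqCoreFrameOnTree_of_imcEqAllFrames_of_bdpExists` with its `(A206, Semistable W)` replaced by
H2 — the existence of a frame is exactly what H2 carries on non-semistable pairs. CONDITIONAL on H2,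
H3∀′ (open). [cite: Castella2018, Thm. 3.1 (arXiv:1704.06608 p. 9)] [cite: Castella2018Erratum, Thm. 1.1 (p. 1)] -/
theorem imcEqCoreFrameOnTree_of_bdpValueCoreFrame_of_imcEqAllFrames
    (h2 : R1.BDPValueCoreFrameOnTree W p) (h3 : R1.IMCEqAllFramesOnTree W p) :
    R1.IMCEqCoreFrameOnTree W p := by
  intro _ q _ K _ _ Dt H w₀ P hE hr hqp hmq hns hvq hK hCas hP hc hinf κ hκ γ _ ι' e he
  obtain ⟨ΩK, Ωp, L, hΩ, hL, -⟩ :=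
    h2 q K Dt H w₀ P hE hr hqp hmq hns hvq hK hCas hP hc hinf κ hκ γ ι' e he
  exact ⟨ΩK, Ωp, L, hΩ, hL, h3 q K Dt H w₀.embedding P hE hr hqp hmq hns hvq hK hCas hP hc hinf Dt.f
    Dt.isNewformOf κ hκ γ ι' w₀ ΩK Ωp L hΩ hL⟩

/-- **H2 ∧ H3∀′ ⟹ the ONE-SIDED core shape H3♭** (`P2.IMCDivIntCoreFrameAtErratumData`, the input
of p417457's one-sided reduction): read the `R₀`-frame in `𝓞_{ℂ_p}⟦T⟧`
(`R1.imcEqIntCoreFrameOnTree_of_imcEqCoreFrame`) and keep one inclusion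
(`P2.imcDivIntCoreFrameAtErratumData_of_imcEqIntCoreFrame`). CONDITIONAL on H2, H3∀′ (open).
[cite: Castella2018Erratum, Thm. 1.1 and (2.4) (pp. 1, 4)] [cite: Castella2018, Thm. 3.1 (arXiv:1704.06608 p. 9)] -/
theorem imcDivIntCoreFrameAtErratumData_of_bdpValueCoreFrame_of_imcEqAllFrames
    (h2 : R1.BDPValueCoreFrameOnTree W p) (h3 : R1.IMCEqAllFramesOnTree W p) :
    P2.IMCDivIntCoreFrameAtErratumData W p :=
  P2.imcDivIntCoreFrameAtErratumData_of_imcEqIntCoreFrame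
    (R1.imcEqIntCoreFrameOnTree_of_imcEqCoreFrame
      (imcEqCoreFrameOnTree_of_bdpValueCoreFrame_of_imcEqAllFrames h2 h3))

end Frames

/-! ### §2 The open input on `R1Population ∩ Locus` by the EQUALITY road -/

section Locus

variable (W : WeierstrassCurve ℚ) [W.IsElliptic] [W.IsGloballyMinimal] (p : ℕ) [Fact p.Prime]

/-- **THE EQUALITY ROAD on `R1Population ∩ Locus`.** For a globally minimal elliptic `W/ℚ` and a prime
`p` with `R1Population W p` and `p ∤ ∏_ℓ c_ℓ(E)`: route p2's open input `P2OpenInputOnTreeAt W p`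
follows from H2 (`R1.BDPValueCoreFrameOnTree W p`) and H3∀′ (`R1.IMCEqAllFramesOnTree W p`, the
erratum's Thm. 1.1 at every frame), given NINE published named facts (`hGZ86` Gross–Zagier 1986
I.7.3, `hGZK`, `hSk` Skinner 2016 Thm. C, `hnf` modularity, `hCST` Cai–Shu–Tian 2014 Thm. 1.1, `hFH`
Friedberg–Hoffstein (ramified form), `hMaz` Mazur 1978 Cor. 4.1, `hGZ` ∕ `hKo` Gross–Zagier ∕ Kolyvagin
over `K`) and FIVE cited ones (`hPT`, `hPT2`, `hEP`, `hcd`, `hBr` Brink 2007). Proof: §1 gives H3∃⁻;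
route R1's equality record `R1.bsdp_of_bdpValueCoreFrame_of_imcEqCoreFrame_record` gives `BSD(E,p)`
(no Euler-system half needed); control on the Locus (`p2ControlOnTreeAt_of_locus`) and tightness
(`P2.openInputOnTreeAt_of_bsdp_of_ram`) give the open input at every classical datum (`r_an = 1` is
one of its binders). CONDITIONAL on H2, H3∀′; nothing booked.
[cite: Castella2018Erratum, Thm. 1.1 (i)–(iv) (p. 1), proof of Thm. 1.1 (p. 4)]
[cite: Castella2018, Thm. 2.3 (p. 5), Thms. 3.1–3.2 (p. 9), §5 (p. 12) (arXiv:1704.06608)]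
[cite: JetchevSkinnerWan2017, Thm. 3.3.1 and §7.4.1 (arXiv:1512.06894 pp. 11, 30)]
[cite: Skinner2016PacificMC, Thm. C (§1)] [cite: Miller2011LMS, Def. 1.1] -/
theorem openInputOnTreeAt_of_r1Population_of_not_dvd_of_bdpValueCoreFrame_of_imcEqAllFrames
    -- route R1's published inputs
    (hGZ86 : GrossZagier1986_thm_I_7_3) (hGZK : rank_eq_analyticRank_of_analyticRank_le_one)
    (hSk : Skinner2016.thmC_padicValRat_bsd_rank_zero) (hnf : exists_isNewformOf)
    (hCST : CaiShuTian2014.thm11_trivialChar)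
    (hFH : friedbergHoffstein_exists_twist_ne_zero_ramifiedAt)
    (hMaz : mazur_not_dvd_maninConstant_of_odd)
    -- Kolyvagin's finiteness and Gross–Zagier over `K` (control on the Locus, tightness)
    (hGZ : ∀ (N : ℕ) [NeZero N] (W : WeierstrassCurve ℚ) (K : Type) [Field K] [NumberField K],
      gross_zagier N W K)
    (hKo : ∀ (N : ℕ) [NeZero N] (W : WeierstrassCurve ℚ) (K : Type) [Field K] [NumberField K],
      kolyvagin N W K)
    -- cited
    (hPT : ∀ (K : Type) [Field K] [NumberField K], poitouTate_selmerStructure_duality K)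
    (hPT2 : ∀ (K : Type) [Field K] [NumberField K], poitouTate_sha_tateDual K)
    (hEP : ∀ (K : Type) [Field K] [NumberField K] (v : HeightOneSpectrum (𝓞 K)),
      localEulerPoincareCharacteristic (v.adicCompletion K))
    (hcd : fieldCdLE_two_of_numberField)
    (hBr : ∀ (K : Type) [Field K] [NumberField K] (p : ℕ) [Fact p.Prime],
      ZpExtension.decomp_not_le_kerSubgroup_of_isAnticyclotomic K p)
    -- the two shapes (OPEN)
    (h2 : R1.BDPValueCoreFrameOnTree W p) (h3 : R1.IMCEqAllFramesOnTree W p)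
    -- the pair: on `R1Population ∩ Locus`
    (hW : R1Population W p) (htam : ¬ p ∣ W.tamagawaProduct) : P2OpenInputOnTreeAt W p := by
  refine p2OpenInputOnTreeAt_of_imp (W := W) (p := p) fun hX _hp5 ↦ ?_
  have hr : W.analyticRank = 1 := hX.1
  have hram : Ram W p := hW.1.ram
  have hbsd : BSDp W p :=
    R1.bsdp_of_bdpValueCoreFrame_of_imcEqCoreFrame_record hGZ86 hGZK hSk hnf hCST hFH hMaz hPT hPT2
      hEP hcd hBr h2 (imcEqCoreFrameOnTree_of_bdpValueCoreFrame_of_imcEqAllFrames h2 h3) hW hr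
  exact P2.openInputOnTreeAt_of_bsdp_of_ram W p hGZ hKo hSk hGZK
    (hasEntireLFunction_rat_of_exists_isNewformOf hnf)
    (p2ControlOnTreeAt_of_locus W p hKo hPT hPT2 hEP hcd hX hram htam) hram hbsd

end Locus

/-! ### §3 The SEMISTABLE part of `R1Population`, on or off the Locus, from H3∀′ alone -/

section Semistable

variable (W : WeierstrassCurve ℚ) [W.IsElliptic] [W.IsGloballyMinimal] (p : ℕ) [Fact p.Prime]

/-- **THE EQUALITY ROAD on the SEMISTABLE part of `R1Population` — `p ∣ ∏_ℓ c_ℓ(E)` ALLOWED.** For a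
globally minimal SEMISTABLE elliptic `W/ℚ` and a prime `p` with `R1Population W p`: route p2's open
input `P2OpenInputOnTreeAt W p` follows from H3∀′ (`R1.IMCEqAllFramesOnTree W p`) ALONE among the
typed shapes, given ELEVEN published named facts — the nine of §2 plus `h32` (Cas18 Thms. 3.1–3.2:
H2 on semistable pairs, `R1.bdpValueCoreFrameOnTree_of_thm32`) and `h23` (Cas18 Thm. 2.3, the control
IDENTITY at `p ∣ N` for semistable `E`, `p2ControlOnTreeAt_of_thm23_of_semistable`, which needs no
`p ∤ ∏c`) — and the five cited facts. Route R1's equality record gives `BSD(E,p)` on ALL of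
`R1Population` (no Euler-system half, no `p`-adic height certificate), and tightness transports it.
So on these pairs the crux is reduced to the erratum's Thm. 1.1 in tree currency and nothing else
typed. CONDITIONAL on H3∀′ (open); nothing booked. [cite: Castella2018Erratum, Thm. 1.1 (p. 1), proof (p. 4)]
[cite: Castella2018, Thm. 2.3 (p. 5), Thms. 3.1–3.2 (p. 9), §5 (p. 12) (arXiv:1704.06608)]
[cite: JetchevSkinnerWan2017, Thm. 3.3.1 and §7.4.1 (arXiv:1512.06894 pp. 11, 30)]
[cite: Skinner2016PacificMC, Thm. C (§1)] [cite: Miller2011LMS, Def. 1.1] -/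
theorem openInputOnTreeAt_of_r1Population_of_semistable_of_imcEqAllFrames
    (hGZ86 : GrossZagier1986_thm_I_7_3) (hGZK : rank_eq_analyticRank_of_analyticRank_le_one)
    (hSk : Skinner2016.thmC_padicValRat_bsd_rank_zero) (hnf : exists_isNewformOf)
    (hCST : CaiShuTian2014.thm11_trivialChar)
    (hFH : friedbergHoffstein_exists_twist_ne_zero_ramifiedAt)
    (hMaz : mazur_not_dvd_maninConstant_of_odd)
    (h32 : thm32_exists_isBDPLFunction_valueAtOne) (h23 : thm23_anticyclotomicControl)
    (hGZ : ∀ (N : ℕ) [NeZero N] (W : WeierstrassCurve ℚ) (K : Type) [Field K] [NumberField K],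
      gross_zagier N W K)
    (hKo : ∀ (N : ℕ) [NeZero N] (W : WeierstrassCurve ℚ) (K : Type) [Field K] [NumberField K],
      kolyvagin N W K)
    (hPT : ∀ (K : Type) [Field K] [NumberField K], poitouTate_selmerStructure_duality K)
    (hPT2 : ∀ (K : Type) [Field K] [NumberField K], poitouTate_sha_tateDual K)
    (hEP : ∀ (K : Type) [Field K] [NumberField K] (v : HeightOneSpectrum (𝓞 K)),
      localEulerPoincareCharacteristic (v.adicCompletion K))
    (hcd : fieldCdLE_two_of_numberField)
    (hBr : ∀ (K : Type) [Field K] [NumberField K] (p : ℕ) [Fact p.Prime],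
      ZpExtension.decomp_not_le_kerSubgroup_of_isAnticyclotomic K p)
    (h3 : R1.IMCEqAllFramesOnTree W p)
    (hss : Semistable W) (hW : R1Population W p) : P2OpenInputOnTreeAt W p := by
  refine p2OpenInputOnTreeAt_of_imp (W := W) (p := p) fun hX _hp5 ↦ ?_
  have hr : W.analyticRank = 1 := hX.1
  have hram : Ram W p := hW.1.ram
  have h2 : R1.BDPValueCoreFrameOnTree W p := R1.bdpValueCoreFrameOnTree_of_thm32 h32 hss
  have hbsd : BSDp W p :=
    R1.bsdp_of_bdpValueCoreFrame_of_imcEqCoreFrame_record hGZ86 hGZK hSk hnf hCST hFH hMaz hPT hPT2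
      hEP hcd hBr h2 (imcEqCoreFrameOnTree_of_bdpValueCoreFrame_of_imcEqAllFrames h2 h3) hW hr
  exact P2.openInputOnTreeAt_of_bsdp_of_ram W p hGZ hKo hSk hGZK
    (hasEntireLFunction_rat_of_exists_isNewformOf hnf)
    (p2ControlOnTreeAt_of_thm23_of_semistable W p h23 hKo hss) hram hbsd

/-- **Non-semistable twin off the Locus needs H2 and the control IDENTITY as a hypothesis.** For
`(W, p)` on `R1Population` (any conductor, `p ∣ ∏c` allowed): H2 ∧ H3∀′ ∧ the PUB-shaped control
identity `P2ControlOnTreeAt W p` (Cas18 Thm. 2.3 ∕ JSW17 Thm. 3.3.1 on the constructed `X_ac` — a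
theorem on the Locus and on semistable pairs, a HYPOTHESIS here) ⟹ `P2OpenInputOnTreeAt W p`.
Records exactly what the non-semistable `p ∣ ∏c` pairs of `R1Population` still ask of the tree.
CONDITIONAL; nothing booked. [cite: Castella2018, Thm. 2.3 (arXiv:1704.06608 p. 5)]
[cite: Castella2018Erratum, Thm. 1.1 (p. 1)] [cite: Miller2011LMS, Def. 1.1] -/
theorem openInputOnTreeAt_of_r1Population_of_control_of_bdpValueCoreFrame_of_imcEqAllFrames
    (hGZ86 : GrossZagier1986_thm_I_7_3) (hGZK : rank_eq_analyticRank_of_analyticRank_le_one)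
    (hSk : Skinner2016.thmC_padicValRat_bsd_rank_zero) (hnf : exists_isNewformOf)
    (hCST : CaiShuTian2014.thm11_trivialChar)
    (hFH : friedbergHoffstein_exists_twist_ne_zero_ramifiedAt)
    (hMaz : mazur_not_dvd_maninConstant_of_odd)
    (hGZ : ∀ (N : ℕ) [NeZero N] (W : WeierstrassCurve ℚ) (K : Type) [Field K] [NumberField K],
      gross_zagier N W K)
    (hKo : ∀ (N : ℕ) [NeZero N] (W : WeierstrassCurve ℚ) (K : Type) [Field K] [NumberField K],
      kolyvagin N W K)
    (hPT : ∀ (K : Type) [Field K] [NumberField K], poitouTate_selmerStructure_duality K)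
    (hPT2 : ∀ (K : Type) [Field K] [NumberField K], poitouTate_sha_tateDual K)
    (hEP : ∀ (K : Type) [Field K] [NumberField K] (v : HeightOneSpectrum (𝓞 K)),
      localEulerPoincareCharacteristic (v.adicCompletion K))
    (hcd : fieldCdLE_two_of_numberField)
    (hBr : ∀ (K : Type) [Field K] [NumberField K] (p : ℕ) [Fact p.Prime],
      ZpExtension.decomp_not_le_kerSubgroup_of_isAnticyclotomic K p)
    (h2 : R1.BDPValueCoreFrameOnTree W p) (h3 : R1.IMCEqAllFramesOnTree W p)
    (hC : P2ControlOnTreeAt W p) (hW : R1Population W p) : P2OpenInputOnTreeAt W p := by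
  refine p2OpenInputOnTreeAt_of_imp (W := W) (p := p) fun hX _hp5 ↦ ?_
  have hr : W.analyticRank = 1 := hX.1
  have hram : Ram W p := hW.1.ram
  have hbsd : BSDp W p :=
    R1.bsdp_of_bdpValueCoreFrame_of_imcEqCoreFrame_record hGZ86 hGZK hSk hnf hCST hFH hMaz hPT hPT2
      hEP hcd hBr h2 (imcEqCoreFrameOnTree_of_bdpValueCoreFrame_of_imcEqAllFrames h2 h3) hW hr
  exact P2.openInputOnTreeAt_of_bsdp_of_ram W p hGZ hKo hSk hGZK
    (hasEntireLFunction_rat_of_exists_isNewformOf hnf) hC hram hbsd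

end Semistable

/-! ### §4 Class-level forms for the planner's split -/

section ClassLevel

/-- **Child R from H2 ∧ H3∀′ (class level).** Given the 9 + 5 named facts of §2 and, at every pair,
H2 `R1.BDPValueCoreFrameOnTree W p` and H3∀′ `R1.IMCEqAllFramesOnTree W p`, the `R1Population ∩ Locus`
part of the crux `OpenInputIMC` holds — child R of p417457's split, VERBATIM. CONDITIONAL; nothing
booked. [cite: Castella2018Erratum, Thm. 1.1 (p. 1)] [cite: Miller2011LMS, Def. 1.1] -/
theorem openInputIMC_r1Locus_of_bdpValueCoreFrame_of_imcEqAllFrames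
    (hGZ86 : GrossZagier1986_thm_I_7_3) (hGZK : rank_eq_analyticRank_of_analyticRank_le_one)
    (hSk : Skinner2016.thmC_padicValRat_bsd_rank_zero) (hnf : exists_isNewformOf)
    (hCST : CaiShuTian2014.thm11_trivialChar)
    (hFH : friedbergHoffstein_exists_twist_ne_zero_ramifiedAt)
    (hMaz : mazur_not_dvd_maninConstant_of_odd)
    (hGZ : ∀ (N : ℕ) [NeZero N] (W : WeierstrassCurve ℚ) (K : Type) [Field K] [NumberField K],
      gross_zagier N W K)
    (hKo : ∀ (N : ℕ) [NeZero N] (W : WeierstrassCurve ℚ) (K : Type) [Field K] [NumberField K],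
      kolyvagin N W K)
    (hPT : ∀ (K : Type) [Field K] [NumberField K], poitouTate_selmerStructure_duality K)
    (hPT2 : ∀ (K : Type) [Field K] [NumberField K], poitouTate_sha_tateDual K)
    (hEP : ∀ (K : Type) [Field K] [NumberField K] (v : HeightOneSpectrum (𝓞 K)),
      localEulerPoincareCharacteristic (v.adicCompletion K))
    (hcd : fieldCdLE_two_of_numberField)
    (hBr : ∀ (K : Type) [Field K] [NumberField K] (p : ℕ) [Fact p.Prime],
      ZpExtension.decomp_not_le_kerSubgroup_of_isAnticyclotomic K p)
    (h2 : ∀ (W : WeierstrassCurve ℚ) [W.IsElliptic] [W.IsGloballyMinimal] (p : ℕ) [Fact p.Prime],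
      R1.BDPValueCoreFrameOnTree W p)
    (h3 : ∀ (W : WeierstrassCurve ℚ) [W.IsElliptic] [W.IsGloballyMinimal] (p : ℕ) [Fact p.Prime],
      R1.IMCEqAllFramesOnTree W p) :
    ∀ (W : WeierstrassCurve ℚ) [W.IsElliptic] [W.IsGloballyMinimal] (p : ℕ) [Fact p.Prime],
      R1Population W p → ¬ p ∣ W.tamagawaProduct → P2OpenInputOnTreeAt W p :=
  fun W _ _ p _ hW htam ↦
    openInputOnTreeAt_of_r1Population_of_not_dvd_of_bdpValueCoreFrame_of_imcEqAllFrames W p hGZ86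
      hGZK hSk hnf hCST hFH hMaz hGZ hKo hPT hPT2 hEP hcd hBr (h2 W p) (h3 W p) hW htam

/-- **The semistable piece of child ram′ from H3∀′ (class level).** Given the 11 + 5 named facts of §3
and H3∀′ at every pair, the crux holds at every SEMISTABLE pair of `R1Population` — in particular at
its semistable `p ∣ ∏c` pairs, which lie in child ram′ of p417457's split (off the Locus).
CONDITIONAL; nothing booked. [cite: Castella2018Erratum, Thm. 1.1 (p. 1)] [cite: Castella2018, Thm. 2.3 (arXiv:1704.06608 p. 5)]
[cite: Miller2011LMS, Def. 1.1] -/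
theorem openInputIMC_r1Semistable_of_imcEqAllFrames
    (hGZ86 : GrossZagier1986_thm_I_7_3) (hGZK : rank_eq_analyticRank_of_analyticRank_le_one)
    (hSk : Skinner2016.thmC_padicValRat_bsd_rank_zero) (hnf : exists_isNewformOf)
    (hCST : CaiShuTian2014.thm11_trivialChar)
    (hFH : friedbergHoffstein_exists_twist_ne_zero_ramifiedAt)
    (hMaz : mazur_not_dvd_maninConstant_of_odd)
    (h32 : thm32_exists_isBDPLFunction_valueAtOne) (h23 : thm23_anticyclotomicControl)
    (hGZ : ∀ (N : ℕ) [NeZero N] (W : WeierstrassCurve ℚ) (K : Type) [Field K] [NumberField K],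
      gross_zagier N W K)
    (hKo : ∀ (N : ℕ) [NeZero N] (W : WeierstrassCurve ℚ) (K : Type) [Field K] [NumberField K],
      kolyvagin N W K)
    (hPT : ∀ (K : Type) [Field K] [NumberField K], poitouTate_selmerStructure_duality K)
    (hPT2 : ∀ (K : Type) [Field K] [NumberField K], poitouTate_sha_tateDual K)
    (hEP : ∀ (K : Type) [Field K] [NumberField K] (v : HeightOneSpectrum (𝓞 K)),
      localEulerPoincareCharacteristic (v.adicCompletion K))
    (hcd : fieldCdLE_two_of_numberField)
    (hBr : ∀ (K : Type) [Field K] [NumberField K] (p : ℕ) [Fact p.Prime],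
      ZpExtension.decomp_not_le_kerSubgroup_of_isAnticyclotomic K p)
    (h3 : ∀ (W : WeierstrassCurve ℚ) [W.IsElliptic] [W.IsGloballyMinimal] (p : ℕ) [Fact p.Prime],
      R1.IMCEqAllFramesOnTree W p) :
    ∀ (W : WeierstrassCurve ℚ) [W.IsElliptic] [W.IsGloballyMinimal] (p : ℕ) [Fact p.Prime],
      Semistable W → R1Population W p → P2OpenInputOnTreeAt W p :=
  fun W _ _ p _ hss hW ↦
    openInputOnTreeAt_of_r1Population_of_semistable_of_imcEqAllFrames W p hGZ86 hGZK hSk hnf hCST hFH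
      hMaz h32 h23 hGZ hKo hPT hPT2 hEP hcd hBr (h3 W p) hss hW

end ClassLevel

end Summit.BirchSwinnertonDyer.BirchSwinnertonDyer.Theorems

end
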